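import Literature.MathematicalPhysics.QuantumFieldTheory.Balaban1983to89.B1Eq333FluctuationIntegrals
import Literature.MathematicalPhysics.QuantumFieldTheory.Balaban1983to89.B2Eq228Conditioning

/-!
# `Balaban1983to89.B1Eq335FluctuationMeasure` — [Balaban1982Higgs1] p. 617/(3.35) p. 618: the fluctuation integrals
`∫dA′_{k−1}e^{−½⟨A′_{k−1},(C^{(k−1)})⁻¹A′_{k−1}⟩}⋯∫dA′₀e^{−½⟨A′₀,(C^{(0)})⁻¹A′₀⟩}(·)` of (3.35), NORMALISED: the k-fold
renormalization transformation with translations (`B1Eq333FluctuationIntegrals.rtIter_eq`) as constants × the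
iterated EXPECTATION over independent centred Gaussian fields `A′_j` with the covariances C^{(j),L^jε} — the
probability measures `B2Eq228Conditioning.gaussProb` that `B1Eq333GaussianFields` (r14) takes as the laws of the A′_j

HONEST FRAMING (cell `lit-balaban`, verbatim): statement-level skeleton of published theorems with citation tags;
proofs where landed; nothing here is a claim about the Yang–Mills mass gap.

CITATION HEADER.  T. Bałaban, *(Higgs)₂,₃ quantum fields in a finite volume. I. A lower bound*, Commun. Math.
Phys. **85** (1982) 603–626, doi:10.1007/bf01403506 [Balaban1982Higgs1] (cell paper B1; PDF held
`paper:balaban1982-cmp85-higgs23-i`, journal page = PDF page + 602; pp. 617–618 READ AS IMAGES on the ×2 renders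
`run/shared/lean/pub/pub-balaban/b2b-balaban-ref1/pages/1982-cmp85-higgs23-I/…-p015/p016-x2.png`).  Unit
`lit-balaban-p14` (Phase-2 proof seat p14, gen 6; companion of `B1Eq333FluctuationIntegrals`, same seat), HOME
`run/shared/lean/pub/lit-balaban/`; SKELETON rows **B1.Eq3.33** (p. 617 sentence *"The fields A′_j defining the
components of (3.33) are independent Gaussian random variables with the covariances C^{(j),L^jε}. Also they are
independent of the field A on the L^kε-lattice, defining the configuration A^{(k),ε}."*) and **B1.Eq3.35** (the
fluctuation integrals of (3.35)).

WHAT IS PRINTED (verbatim, p. 618 [PDF 16], (3.35)): *"E_k(e′,λ′,eA^{(k),ε},φ) = −log[(a(L^kε)^{d−2}/2π)^{(d/2)|T₁^{(k)}|}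
·∫dA′_{k−1}exp(−½⟨A′_{k−1},(C^{(k−1),L^{k−1}ε})⁻¹A′_{k−1}⟩)·…·(a(Lε)^{d−2}/2π)^{(d/2)|T₁^{(1)}|}∫dA′₀
exp(−½⟨A′₀,(C^{(0),ε})⁻¹A′₀⟩)·T^ε_{a_k,L^k,eA^{(k),ε}+e′Σ_{j=0}^{k−1}A′^{(j),ε}}[…]]"* — the fluctuation fields are
integrated against the product over j of the centred Gaussian densities with covariance operators C^{(j),L^jε};
dividing each by its mass `∫dA′_je^{−½⟨A′_j,(C^{(j)})⁻¹A′_j⟩}` makes them the probability laws of the sentence p. 617.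

WHAT THIS MODULE PROVES (0 `sorry`, axioms standard; one `def` — the nest `fluctMean` against the probability
measures — and theorems only otherwise; carrier and notation as in `B1Eq333FluctuationIntegrals`: tower `T`, weights `WE`, `W j`,
kernel constants `c j`, `(C^{(0)})⁻¹ = H + α₁Q*₁Q₁ = G₁⁻¹`, `(C^{(j)})⁻¹ = β_jP + Δ^{(j)}`; as matrices for the plain
dot product the Gaussian weights are `gaussWeight (W_j(C^{(j)})⁻¹)`, `B13GaugeDevices.gaussWeight M x = e^{−½x⬝Mx}`):
* `flW_eq_gaussWeight`, `integral_gaussWeight_mul` — each level's weight is the tree's `gaussWeight`, and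
  `∫dA′ e^{−½⟨A′,MA′⟩}g(A′) = gaussNorm M · ∫g d(gaussProb M)` whenever the mass `gaussNorm M ≠ 0`
  (`B2Eq228Conditioning.integral_gaussProb`; positive definite `M` ⇒ `gaussNorm_pos`);
* `fluctInt_eq_fluctMean` — `fluctInt Φ n v = (∏_{j=1}^{n}gaussNorm(W_j(C^{(j)})⁻¹))·fluctMean Φ n v`;
* `rtIter_eq_mean` — **the p. 617 sentence in probabilistic form**: after n + 1 steps the density at `B` is
  `(∏c_j)·e^{−½⟨B,Δ^{(n+1)}B⟩_{n+1}}·Z₀·(∏_{j=1}^{n}Z_j)·∫dμ_n(A′_n)⋯∫dμ_1(A′_1)∫dμ₀(A′₀) F(A′₀ + Σ_{j=1}^{n}α_jG_jQ*_jA′_j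
  + α_{n+1}G_{n+1}Q*_{n+1}B)`, `dμ_j = gaussProb (W_j(C^{(j)})⁻¹)` (covariance C^{(j)} for `⟨·,·⟩_j`), `dμ₀ = gaussProb
  (W_E(C^{(0)})⁻¹)` — independent (iterated product integral) Gaussian A′_j, independent of `B`, the integrand at (3.33).
* §3–§4 `Δk_form_nonneg`, `cinv_form_pos`, `gaussNorm_cinv_pos`, `gaussNorm_ginv_pos`, `law_isProbabilityMeasure`,
  `law₀_isProbabilityMeasure`, `rtIter_eq_mean'` — the NON-DEGENERACY DISCHARGED from the Euclidean structure: Δ^{(k)} ≥ 0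
  for `⟨·,·⟩_K` (the completed square (3.11) at A′ = 0: `½⟨ψ,Δ^{(k)}ψ⟩` is the value of the non-negative step form at its
  minimiser), hence `(C^{(k)})⁻¹ = a(L^{k+1}ε)⁻²P + Δ^{(k)} ≥ 0`, and PSD + symmetric + invertible (*"It is so"*, p. 611)
  ⇒ positive definite ⇒ `W_K(C^{(k)})⁻¹` is `Matrix.PosDef` ⇒ the laws `gaussProb` ARE probability measures with positive
  masses (`B2Eq228Conditioning.isProbabilityMeasure_gaussProb`/`gaussNorm_pos`) — the `posDef` field that
  `B1Eq333GaussianFields.FluctData` assumes, derived; `rtIter_eq_mean'` = `rtIter_eq_mean` with only the positivity of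
  `⟨·,·⟩_E` added to the hypotheses of `rtIter_eq`.
Scope: the repackaging of the iterated integral as ONE integral against `Measure.pi` (Fubini) — the form in which
`B1Eq333GaussianFields` states independence — is not done here; quantitative bounds (Prop. 2.3 (2.33): γ₀, γ₁ uniform)
are untouched (only qualitative positivity on a finite lattice).
-/

namespace Literature.MathematicalPhysics.QuantumFieldTheory.Balaban1983to89.B1Eq335FluctuationMeasure

open MeasureTheory Matrix B1RG242 B1RG242.StepData B1Eq333FluctuationIntegrals

variable {ι : Type} [Fintype ι] [DecidableEq ι] (T : B1RG242.Tower ℝ ι)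
  (WE : Matrix ι ι ℝ) (W : ∀ j, Matrix (T.κ j) (T.κ j) ℝ) (c : ℕ → ℝ)

/-! ## 1. The weighted inverse covariances and the nest against the probability measures -/

/-- `M_j := W_j·(C^{(j),L^jε})⁻¹ = W_j(a(L^{j+1}ε)⁻²P + Δ^{(j),L^jε})` (2.30): the matrix of the level-j Gaussian weight of
(3.35) for the plain dot product (`flW_eq_gaussWeight`: `e^{−½⟨A′,(C^{(j)})⁻¹A′⟩_j} = gaussWeight M_j A′`), j ≥ 1; the law
of A′_j is `dμ_j = gaussProb M_j`. [cite: Balaban1982Higgs1, (2.30) p.611] -/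
noncomputable def cinvW (j : ℕ) : Matrix (T.κ j) (T.κ j) ℝ := W j * ((T.step j).β • (T.step j).P + (T.step j).Δk)

/-- `M₀ := W_E·(C^{(0),ε})⁻¹ = W_E(a(Lε)⁻²Q*₁Q₁ + (−Δ^ε + m²)) = W_E(G^ε_1)⁻¹` (p. 612 *"the identity G^ε_1 = C^{(0),ε}"*):
the matrix of the level-0 weight (`flW₀_eq_gaussWeight`); `dμ₀ = gaussProb M₀`. [cite: Balaban1982Higgs1, (2.20) p.610] -/
noncomputable def ginvW : Matrix ι ι ℝ := WE * (T.α 1 • (T.Qks 1 * T.Qk 1) + T.H)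

/-- The nest of (3.35) against the PROBABILITY measures: `fluctMean Φ n v = ∫dμ_n(A′_n)⋯∫dμ_1(A′_1) Φ(v + Σ_j
α_jG_jQ*_jA′_j)`, `dμ_j = B2Eq228Conditioning.gaussProb (W_j(C^{(j)})⁻¹)` — p15's centred Gaussian probability
measure, here of covariance C^{(j)} for `⟨·,·⟩_j` (the laws `law j` of r14's `B1Eq333GaussianFields`).
[cite: Balaban1982Higgs1, (3.35) p.618] -/
noncomputable def fluctMean (Φ : (ι → ℝ) → ℝ) : ℕ → (ι → ℝ) → ℝ
  | 0 => Φ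
  | n + 1 => fun v => ∫ A' : T.κ (n + 1) → ℝ, fluctMean Φ n (v + bg T (n + 1) A')
      ∂(B2Eq228Conditioning.gaussProb (cinvW T W (n + 1)))

/-! ## 2. Masses × expectations -/

section Normalised

variable {T W}

/-- The level-j weight IS the tree's Gaussian weight `gaussWeight M_j`, `M_j = W_j·(C^{(j)})⁻¹` (the covariance for the
plain dot product is `M_j⁻¹ = C^{(j)}W_j⁻¹`, for `⟨·,·⟩_j` it is C^{(j)}). [cite: Balaban1982Higgs1, (3.35) p.618] -/
theorem flW_eq_gaussWeight (j : ℕ) (A' : T.κ j → ℝ) :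
    flW T W j A' = B13GaugeDevices.gaussWeight (cinvW T W j) A' := by
  simp only [flW, cinvW, B13GaugeDevices.gaussWeight, Matrix.mulVec_mulVec]

/-- Dividing by the Gaussian mass: `∫dA′ e^{−½⟨A′,MA′⟩}g(A′) = (∫e^{−½⟨A′,MA′⟩})·∫g dμ_{M⁻¹}` with `dμ_{M⁻¹}` = p15's
probability measure `gaussProb M`, whenever the mass `B13GaugeDevices.gaussNorm M ≠ 0` (e.g. `M` positive definite,
`B2Eq228Conditioning.gaussNorm_pos`). [cite: Balaban1982Higgs1, (3.35) p.618] -/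
theorem integral_gaussWeight_mul {X : Type} [Fintype X] (M : Matrix X X ℝ) (hM : B13GaugeDevices.gaussNorm M ≠ 0)
    (g : (X → ℝ) → ℝ) :
    ∫ x : X → ℝ, B13GaugeDevices.gaussWeight M x * g x
      = B13GaugeDevices.gaussNorm M * ∫ x, g x ∂(B2Eq228Conditioning.gaussProb M) := by
  rw [B2Eq228Conditioning.integral_gaussProb, B13GaugeDevices.gaussMean, B13GaugeDevices.gaussInt, smul_eq_mul,
    ← mul_assoc, mul_inv_cancel₀ hM, one_mul]
  rfl

/-- **Unnormalised = masses × normalised**: `fluctInt Φ n v = (∏_{j=1}^{n} Z_j)·fluctMean Φ n v`, `Z_j = gaussNorm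
(W_j(C^{(j)})⁻¹)`, when no level is degenerate. [cite: Balaban1982Higgs1, (3.35) p.618] -/
theorem fluctInt_eq_fluctMean (Φ : (ι → ℝ) → ℝ) (n : ℕ)
    (hZ : ∀ j, 1 ≤ j → j ≤ n → B13GaugeDevices.gaussNorm (cinvW T W j) ≠ 0)
    (v : ι → ℝ) :
    fluctInt T W Φ n v
      = (∏ j ∈ Finset.Icc 1 n, B13GaugeDevices.gaussNorm (cinvW T W j))
        * fluctMean T W Φ n v := by
  induction n generalizing v with
  | zero => simp [fluctInt, fluctMean]
  | succ n ih =>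
      have ih' := fun v => ih (fun j hj hjn => hZ j hj (Nat.le_succ_of_le hjn)) v
      show (∫ A' : T.κ (n + 1) → ℝ, flW T W (n + 1) A' * fluctInt T W Φ n (v + bg T (n + 1) A')) = _
      simp_rw [ih', flW_eq_gaussWeight]
      rw [integral_gaussWeight_mul _ (hZ (n + 1) (Nat.succ_pos n) le_rfl), integral_const_mul,
        Finset.prod_Icc_succ_top (Nat.le_add_left 1 n)]
      show _ = _ * ∫ A' : T.κ (n + 1) → ℝ, fluctMean T W Φ n (v + bg T (n + 1) A') ∂_
      ring

variable {WE}

/-- **The p. 617 sentence in probabilistic form**: after `n + 1` steps the density at `B` is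
`(∏c_j)·Z₀·(∏_{j=1}^{n}Z_j)·e^{−½⟨B,Δ^{(n+1)}B⟩}·𝔼[F(A′₀ + Σ_{j=1}^{n}α_jG_jQ*_jA′_j + α_{n+1}G_{n+1}Q*_{n+1}B)]`, the
expectation over INDEPENDENT centred Gaussian fields `A′_j ∼ dμ_j` (covariance C^{(j)}), `A′₀ ∼ dμ₀` (covariance
C^{(0)} = G₁), written as the iterated integral against the probability measures `gaussProb`; `Z₀ = gaussNorm
(W_E(C^{(0)})⁻¹)`. [cite: Balaban1982Higgs1, (3.33) p.617] -/
theorem rtIter_eq_mean (h : T.Consistent) (E : ∀ j, 1 ≤ j → (T.step j).ScalarProducts WE (W j) (W (j + 1)))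
    (symE : ∀ φ ψ : ι → ℝ, φ ⬝ᵥ (WE *ᵥ ψ) = ψ ⬝ᵥ (WE *ᵥ φ))
    (symW : ∀ j, 1 ≤ j → ∀ u v : T.κ j → ℝ, u ⬝ᵥ (W j *ᵥ v) = v ⬝ᵥ (W j *ᵥ u))
    (symH : ∀ φ ψ : ι → ℝ, φ ⬝ᵥ (WE *ᵥ (T.H *ᵥ ψ)) = ψ ⬝ᵥ (WE *ᵥ (T.H *ᵥ φ)))
    (F : (ι → ℝ) → ℝ) (n : ℕ)
    (hZ₀ : B13GaugeDevices.gaussNorm (ginvW T WE) ≠ 0)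
    (hZ : ∀ j, 1 ≤ j → j ≤ n → B13GaugeDevices.gaussNorm (cinvW T W j) ≠ 0)
    (B : T.κ (n + 1) → ℝ) :
    rtIter T WE W c F n B
      = (∏ j ∈ Finset.range (n + 1), c j)
        * (Real.exp (-(1 / 2 * (B ⬝ᵥ (W (n + 1) *ᵥ ((T.step (n + 1)).Δk *ᵥ B)))))
          * ((B13GaugeDevices.gaussNorm (ginvW T WE)
              * ∏ j ∈ Finset.Icc 1 n, B13GaugeDevices.gaussNorm (cinvW T W j))
            * fluctMean T W (fun v => ∫ A' : ι → ℝ, F (A' + v)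
                ∂(B2Eq228Conditioning.gaussProb (ginvW T WE))) n (bg T (n + 1) B))) := by
  rw [rtIter_eq c h E symE symW symH F n B]
  have e0 : (fun v : ι → ℝ => ∫ A' : ι → ℝ, flW₀ T WE A' * F (A' + v))
      = fun v => B13GaugeDevices.gaussNorm (ginvW T WE)
          * ∫ A' : ι → ℝ, F (A' + v) ∂(B2Eq228Conditioning.gaussProb (ginvW T WE)) := by
    funext v
    have ew : ∀ A' : ι → ℝ, flW₀ T WE A' = B13GaugeDevices.gaussWeight (ginvW T WE) A' :=
      fun A' => by simp only [flW₀, ginvW, B13GaugeDevices.gaussWeight, Matrix.mulVec_mulVec]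
    simp_rw [ew]
    exact integral_gaussWeight_mul _ hZ₀ _
  rw [e0, fluctInt_const_mul, fluctInt_eq_fluctMean _ n hZ]
  ring

end Normalised

/-! ## 3. Non-degeneracy from the Euclidean structure: `(C^{(j)})⁻¹`, `(C^{(0)})⁻¹ = G₁⁻¹` are positive definite, so the
laws are genuine probability measures (finite-lattice content of Prop. 2.3 / *"It is so"*, p. 611) -/

section NonDegenerate

variable {X Y E : Type} [Fintype X] [DecidableEq X] [Fintype Y] [Fintype E] [DecidableEq E]

/-- A symmetric operator which is non-negative for a positive definite scalar product `⟨u,v⟩_K = u ⬝ᵥ (W_K *ᵥ v)` and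
injective is positive: PSD + invertible ⇒ PD (finite lattice). [folklore] [cite: Balaban1982Higgs1, (2.33) p.611] -/
theorem form_pos_of_nonneg_of_isUnit {WK M : Matrix X X ℝ} (posK : ∀ u : X → ℝ, u ≠ 0 → 0 < u ⬝ᵥ (WK *ᵥ u))
    (symM : ∀ u v : X → ℝ, u ⬝ᵥ (WK *ᵥ (M *ᵥ v)) = v ⬝ᵥ (WK *ᵥ (M *ᵥ u)))
    (nonneg : ∀ u : X → ℝ, 0 ≤ u ⬝ᵥ (WK *ᵥ (M *ᵥ u))) (hM : IsUnit M) (x : X → ℝ) (hx : x ≠ 0) :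
    0 < x ⬝ᵥ (WK *ᵥ (M *ᵥ x)) := by
  rcases (nonneg x).lt_or_eq with hpos | h0
  · exact hpos
  exfalso
  -- `q(x) = 0` forces `⟨x, My⟩_K = 0` for every `y` (expand `q(x + ty) ≥ 0`)
  have hlin : ∀ y : X → ℝ, x ⬝ᵥ (WK *ᵥ (M *ᵥ y)) = 0 := by
    intro y
    set a := x ⬝ᵥ (WK *ᵥ (M *ᵥ y)) with ha
    set b := y ⬝ᵥ (WK *ᵥ (M *ᵥ y)) with hb
    have hb0 : 0 ≤ b := nonneg y
    have hq : ∀ t : ℝ, 0 ≤ 2 * t * a + t ^ 2 * b := by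
      intro t
      have h1 := nonneg (x + t • y)
      have e : (x + t • y) ⬝ᵥ (WK *ᵥ (M *ᵥ (x + t • y)))
          = x ⬝ᵥ (WK *ᵥ (M *ᵥ x)) + 2 * t * a + t ^ 2 * b := by
        simp only [Matrix.mulVec_add, Matrix.mulVec_smul, dotProduct_add, add_dotProduct, dotProduct_smul,
          smul_dotProduct, smul_eq_mul]
        rw [symM y x]
        ring
      rw [e, ← h0] at h1
      linarith
    by_contra hne
    have ht := hq (-a / (b + 1))
    have e2 : 2 * (-a / (b + 1)) * a + (-a / (b + 1)) ^ 2 * b = -(a ^ 2 * (b + 2) / (b + 1) ^ 2) := by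
      field_simp
      ring
    have hneg : 0 < a ^ 2 * (b + 2) / (b + 1) ^ 2 := by positivity
    rw [e2] at ht
    linarith
  -- hence `W_K(Mx) = 0`, so `Mx = 0`, so `x = 0`
  have hWMx : WK *ᵥ (M *ᵥ x) = 0 := by
    refine dotProduct_eq_zero _ (fun w => ?_)
    rw [dotProduct_comm, symM w x]
    exact hlin w
  have hMx : M *ᵥ x = 0 := by
    by_contra hne
    have h2 := posK _ hne
    rw [hWMx, dotProduct_zero] at h2
    exact lt_irrefl _ h2
  have hinj := Matrix.mulVec_injective_iff_isUnit.mpr hM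
  exact hx (hinj (by rw [hMx, Matrix.mulVec_zero]))

omit [DecidableEq X] in
/-- The matrix `W_K·M` of the form `⟨u,Mv⟩_K` is positive definite (Mathlib `Matrix.PosDef`) when `⟨·,·⟩_K` is symmetric, `M`
is `⟨·,·⟩_K`-symmetric (so that `W_K·M` is a symmetric matrix) and `⟨x,Mx⟩_K > 0` for `x ≠ 0` — the hypothesis of `B2Eq228Conditioning.gaussNorm_pos` /
`isProbabilityMeasure_gaussProb`. [folklore] [cite: Balaban1982Higgs1, (2.33) p.611] -/
theorem posDef_weight_mul {WK M : Matrix X X ℝ}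
    (symM : ∀ u v : X → ℝ, u ⬝ᵥ (WK *ᵥ (M *ᵥ v)) = v ⬝ᵥ (WK *ᵥ (M *ᵥ u)))
    (pos : ∀ x : X → ℝ, x ≠ 0 → 0 < x ⬝ᵥ (WK *ᵥ (M *ᵥ x))) : (WK * M).PosDef := by
  refine Matrix.posDef_iff_dotProduct_mulVec.mpr ⟨?_, fun x hx => ?_⟩
  · show (WK * M)ᴴ = WK * M
    rw [Matrix.conjTranspose_eq_transpose_of_trivial]
    refine Matrix.ext_iff_mulVec.mpr (fun v => dotProduct_eq _ _ (fun u => ?_))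
    rw [Matrix.mulVec_transpose, ← Matrix.dotProduct_mulVec, ← Matrix.mulVec_mulVec, symM v u,
      dotProduct_comm, ← Matrix.mulVec_mulVec]
  · have e : star x = x := funext fun i => star_trivial (x i)
    rw [e, ← Matrix.mulVec_mulVec]
    exact pos x hx

variable (S : B1RG242.StepData ℝ E X Y) {WE : Matrix E E ℝ} {WK : Matrix X X ℝ} {WM : Matrix Y Y ℝ}

/-- `Δ^{(k),L^kε} ≥ 0` for `⟨·,·⟩_K`: by the completed square (3.11) at `A′ = 0` (`B1Eq314Proof.split311_matrix`),
`½⟨ψ,Δ^{(k)}ψ⟩_K` is the value of the non-negative step form `½a_k⟨ψ − Q_kA,·⟩_K + ½⟨A,HA⟩_E` at its minimiser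
`A = a_kG_kQ*_kψ` (the configuration (3.29)). [cite: Balaban1982Higgs1, (2.21) p.610] -/
theorem Δk_form_nonneg (hE : S.ScalarProducts WE WK WM) (symK : ∀ u v : X → ℝ, u ⬝ᵥ (WK *ᵥ v) = v ⬝ᵥ (WK *ᵥ u))
    (symH : ∀ φ ψ : E → ℝ, φ ⬝ᵥ (WE *ᵥ (S.H *ᵥ ψ)) = ψ ⬝ᵥ (WE *ᵥ (S.H *ᵥ φ)))
    (hG : IsUnit (S.H + S.α • S.Pk)) (ψ : X → ℝ) : 0 ≤ ψ ⬝ᵥ (WK *ᵥ (S.Δk *ᵥ ψ)) := by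
  have hGmul : (S.α • (S.Qks * S.Qk) + S.H) * S.Gk = 1 := by
    rw [add_comm]
    exact S.Gk_mul hG
  have hs := B1Eq314Proof.split311_matrix WE WK symK S.α S.Qk S.Qks hE.adjk S.H symH S.Gk hGmul (0 : E → ℝ) ψ
  simp only [B1Sect3Statements.transl310, Matrix.mulVecLin_apply, zero_add, Matrix.mulVec_zero, dotProduct_zero,
    mul_zero, add_zero] at hs
  have hnn : 0 ≤ 1 / 2 * S.α * ((ψ - S.Qk *ᵥ (S.α • S.Gk *ᵥ (S.Qks *ᵥ ψ)))
        ⬝ᵥ (WK *ᵥ (ψ - S.Qk *ᵥ (S.α • S.Gk *ᵥ (S.Qks *ᵥ ψ)))))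
      + 1 / 2 * ((S.α • S.Gk *ᵥ (S.Qks *ᵥ ψ)) ⬝ᵥ (WE *ᵥ (S.H *ᵥ (S.α • S.Gk *ᵥ (S.Qks *ᵥ ψ))))) :=
    add_nonneg (mul_nonneg (mul_nonneg (by norm_num) hE.α_pos.le) (hE.posK_nonneg _))
      (mul_nonneg (by norm_num) (hE.formH _))
  rw [hs] at hnn
  have e : S.Δk = S.α • (1 : Matrix X X ℝ) - S.α ^ 2 • (S.Qk * S.Gk * S.Qks) := rfl
  rw [e]
  linarith

/-- `(C^{(k),L^kε})⁻¹ = a(L^{k+1}ε)⁻²P + Δ^{(k)} ≥ 0` for `⟨·,·⟩_K` (`⟨A,PA⟩_K = ⟨QA,QA⟩_M ≥ 0`).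
[cite: Balaban1982Higgs1, (2.31) p.611] -/
theorem cinv_form_nonneg (hE : S.ScalarProducts WE WK WM) (symK : ∀ u v : X → ℝ, u ⬝ᵥ (WK *ᵥ v) = v ⬝ᵥ (WK *ᵥ u))
    (symH : ∀ φ ψ : E → ℝ, φ ⬝ᵥ (WE *ᵥ (S.H *ᵥ ψ)) = ψ ⬝ᵥ (WE *ᵥ (S.H *ᵥ φ)))
    (hG : IsUnit (S.H + S.α • S.Pk)) (A : X → ℝ) : 0 ≤ A ⬝ᵥ (WK *ᵥ ((S.β • S.P + S.Δk) *ᵥ A)) := by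
  have h1 : A ⬝ᵥ (WK *ᵥ ((S.β • S.P + S.Δk) *ᵥ A))
      = S.β * ((S.Q *ᵥ A) ⬝ᵥ (WM *ᵥ (S.Q *ᵥ A))) + A ⬝ᵥ (WK *ᵥ (S.Δk *ᵥ A)) := by
    have eP : S.P = S.Qs * S.Q := rfl
    rw [Matrix.add_mulVec, Matrix.smul_mulVec, Matrix.mulVec_add, Matrix.mulVec_smul, dotProduct_add,
      dotProduct_smul, smul_eq_mul, eP, ← Matrix.mulVec_mulVec, hE.adj]
  rw [h1]
  exact add_nonneg (mul_nonneg hE.β_pos.le (hE.posM_nonneg _)) (Δk_form_nonneg S hE symK symH hG A)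

/-- `(C^{(k)})⁻¹ = a(L^{k+1}ε)⁻²P + Δ^{(k)}` is symmetric for `⟨·,·⟩_K` (adjointness of Q*, symmetry of Δ^{(k)}
`B1Eq314Proof.stepData_Δk_symm`). [cite: Balaban1982Higgs1, (2.31) p.611] -/
theorem cinv_symm (hE : S.ScalarProducts WE WK WM) (symE : ∀ φ ψ : E → ℝ, φ ⬝ᵥ (WE *ᵥ ψ) = ψ ⬝ᵥ (WE *ᵥ φ))
    (symK : ∀ u v : X → ℝ, u ⬝ᵥ (WK *ᵥ v) = v ⬝ᵥ (WK *ᵥ u))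
    (symM : ∀ u v : Y → ℝ, u ⬝ᵥ (WM *ᵥ v) = v ⬝ᵥ (WM *ᵥ u))
    (symH : ∀ φ ψ : E → ℝ, φ ⬝ᵥ (WE *ᵥ (S.H *ᵥ ψ)) = ψ ⬝ᵥ (WE *ᵥ (S.H *ᵥ φ)))
    (hG : IsUnit (S.H + S.α • S.Pk)) (u v : X → ℝ) :
    u ⬝ᵥ (WK *ᵥ ((S.β • S.P + S.Δk) *ᵥ v)) = v ⬝ᵥ (WK *ᵥ ((S.β • S.P + S.Δk) *ᵥ u)) := by
  have eP : S.P = S.Qs * S.Q := rfl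
  have hP : ∀ u v : X → ℝ, u ⬝ᵥ (WK *ᵥ (S.P *ᵥ v)) = v ⬝ᵥ (WK *ᵥ (S.P *ᵥ u)) := fun u v => by
    rw [eP, ← Matrix.mulVec_mulVec, ← Matrix.mulVec_mulVec, hE.adj, hE.adj, symM]
  have hΔ := B1Eq314Proof.stepData_Δk_symm S symE symK symH hE.adjk hG
  simp only [Matrix.add_mulVec, Matrix.smul_mulVec, Matrix.mulVec_add, Matrix.mulVec_smul, dotProduct_add,
    dotProduct_smul, smul_eq_mul]
  rw [hP u v, hΔ u v]

/-- **`(C^{(k),L^kε})⁻¹` is positive definite for `⟨·,·⟩_K`** on a finite lattice, from the Euclidean structure (1.5), the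
positive semi-definiteness of `−Δ^{ε,N}_{A,Ω} + m²` and the invertibility *"It is so"* (p. 611) — so `C^{(k)}` IS the
covariance of a centred Gaussian probability measure. [cite: Balaban1982Higgs1, (2.31) p.611] -/
theorem cinv_form_pos (hE : S.ScalarProducts WE WK WM) (symE : ∀ φ ψ : E → ℝ, φ ⬝ᵥ (WE *ᵥ ψ) = ψ ⬝ᵥ (WE *ᵥ φ))
    (symK : ∀ u v : X → ℝ, u ⬝ᵥ (WK *ᵥ v) = v ⬝ᵥ (WK *ᵥ u))
    (symM : ∀ u v : Y → ℝ, u ⬝ᵥ (WM *ᵥ v) = v ⬝ᵥ (WM *ᵥ u))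
    (symH : ∀ φ ψ : E → ℝ, φ ⬝ᵥ (WE *ᵥ (S.H *ᵥ ψ)) = ψ ⬝ᵥ (WE *ᵥ (S.H *ᵥ φ)))
    (hG : IsUnit (S.H + S.α • S.Pk)) (hC : IsUnit (S.β • S.P + S.Δk)) (x : X → ℝ) (hx : x ≠ 0) :
    0 < x ⬝ᵥ (WK *ᵥ ((S.β • S.P + S.Δk) *ᵥ x)) :=
  form_pos_of_nonneg_of_isUnit hE.posK (cinv_symm S hE symE symK symM symH hG) (cinv_form_nonneg S hE symK symH hG)
    hC x hx

/-- The level-k Gaussian mass `∫dA′ e^{−½⟨A′,(C^{(k)})⁻¹A′⟩_K}` is positive (finite and non-zero): `W_K(C^{(k)})⁻¹` is a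
positive definite matrix. [cite: Balaban1982Higgs1, (2.31) p.611] -/
theorem gaussNorm_cinv_pos (hE : S.ScalarProducts WE WK WM) (symE : ∀ φ ψ : E → ℝ, φ ⬝ᵥ (WE *ᵥ ψ) = ψ ⬝ᵥ (WE *ᵥ φ))
    (symK : ∀ u v : X → ℝ, u ⬝ᵥ (WK *ᵥ v) = v ⬝ᵥ (WK *ᵥ u))
    (symM : ∀ u v : Y → ℝ, u ⬝ᵥ (WM *ᵥ v) = v ⬝ᵥ (WM *ᵥ u))
    (symH : ∀ φ ψ : E → ℝ, φ ⬝ᵥ (WE *ᵥ (S.H *ᵥ ψ)) = ψ ⬝ᵥ (WE *ᵥ (S.H *ᵥ φ)))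
    (hG : IsUnit (S.H + S.α • S.Pk)) (hC : IsUnit (S.β • S.P + S.Δk)) :
    (WK * (S.β • S.P + S.Δk)).PosDef ∧ 0 < B13GaugeDevices.gaussNorm (WK * (S.β • S.P + S.Δk)) := by
  have hpd := posDef_weight_mul (cinv_symm S hE symE symK symM symH hG)
    (cinv_form_pos S hE symE symK symM symH hG hC)
  exact ⟨hpd, B2Eq228Conditioning.gaussNorm_pos hpd⟩

omit [DecidableEq X] in
/-- Level 0: `(C^{(0),ε})⁻¹ = a(Lε)⁻²Q*₁Q₁ + (−Δ^ε + m²) = (G^ε_1)⁻¹` is positive definite for `⟨·,·⟩_E` (positivity of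
`⟨·,·⟩_E`, `⟨·,·⟩₁`, of H, adjointness, and the existence of G^ε_1), hence its Gaussian mass is positive.
[cite: Balaban1982Higgs1, (2.20) p.610] -/
theorem gaussNorm_ginv_pos (hE : S.ScalarProducts WE WK WM) (posE : ∀ u : E → ℝ, u ≠ 0 → 0 < u ⬝ᵥ (WE *ᵥ u))
    (symK : ∀ u v : X → ℝ, u ⬝ᵥ (WK *ᵥ v) = v ⬝ᵥ (WK *ᵥ u))
    (symH : ∀ φ ψ : E → ℝ, φ ⬝ᵥ (WE *ᵥ (S.H *ᵥ ψ)) = ψ ⬝ᵥ (WE *ᵥ (S.H *ᵥ φ)))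
    (hG : IsUnit (S.H + S.α • S.Pk)) :
    (WE * (S.α • (S.Qks * S.Qk) + S.H)).PosDef
      ∧ 0 < B13GaugeDevices.gaussNorm (WE * (S.α • (S.Qks * S.Qk) + S.H)) := by
  have symN : ∀ u v : E → ℝ, u ⬝ᵥ (WE *ᵥ ((S.α • (S.Qks * S.Qk) + S.H) *ᵥ v))
      = v ⬝ᵥ (WE *ᵥ ((S.α • (S.Qks * S.Qk) + S.H) *ᵥ u)) := fun u v => by
    simp only [Matrix.add_mulVec, Matrix.smul_mulVec, ← Matrix.mulVec_mulVec, Matrix.mulVec_add,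
      Matrix.mulVec_smul, dotProduct_add, dotProduct_smul, smul_eq_mul, symH u v, hE.adjk]
    rw [symK]
  have nonneg : ∀ u : E → ℝ, 0 ≤ u ⬝ᵥ (WE *ᵥ ((S.α • (S.Qks * S.Qk) + S.H) *ᵥ u)) := fun u => by
    simp only [Matrix.add_mulVec, Matrix.smul_mulVec, ← Matrix.mulVec_mulVec, Matrix.mulVec_add,
      Matrix.mulVec_smul, dotProduct_add, dotProduct_smul, smul_eq_mul, hE.adjk]
    exact add_nonneg (mul_nonneg hE.α_pos.le (hE.posK_nonneg _)) (hE.formH u)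
  have hN : IsUnit (S.α • (S.Qks * S.Qk) + S.H) := by
    rw [add_comm]
    exact hG
  have hpd := posDef_weight_mul symN (form_pos_of_nonneg_of_isUnit posE symN nonneg hN)
  exact ⟨hpd, B2Eq228Conditioning.gaussNorm_pos hpd⟩

end NonDegenerate

/-! ## 4. The laws are probability measures; the normalised identity without non-degeneracy hypotheses -/

section Laws

variable {T WE W}

/-- For j ≥ 1 the law `dμ_j = gaussProb (W_j(C^{(j)})⁻¹)` of the fluctuation field A′_j IS a probability measure and its
mass is positive, from the tower's Euclidean structure alone (`T.Consistent`, `ScalarProducts`, symmetric weights and H).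
[cite: Balaban1982Higgs1, (3.33) p.617] -/
theorem law_isProbabilityMeasure (h : T.Consistent) (E : ∀ j, 1 ≤ j → (T.step j).ScalarProducts WE (W j) (W (j + 1)))
    (symE : ∀ φ ψ : ι → ℝ, φ ⬝ᵥ (WE *ᵥ ψ) = ψ ⬝ᵥ (WE *ᵥ φ))
    (symW : ∀ j, 1 ≤ j → ∀ u v : T.κ j → ℝ, u ⬝ᵥ (W j *ᵥ v) = v ⬝ᵥ (W j *ᵥ u))
    (symH : ∀ φ ψ : ι → ℝ, φ ⬝ᵥ (WE *ᵥ (T.H *ᵥ ψ)) = ψ ⬝ᵥ (WE *ᵥ (T.H *ᵥ φ))) (j : ℕ) (hj : 1 ≤ j) :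
    IsProbabilityMeasure (B2Eq228Conditioning.gaussProb (cinvW T W j))
      ∧ 0 < B13GaugeDevices.gaussNorm (cinvW T W j) := by
  have hpos := gaussNorm_cinv_pos (T.step j) (E j hj) symE (symW j hj) (symW (j + 1) (Nat.succ_pos j)) symH
    (h.G_arg j hj) (h.C_arg j hj)
  exact ⟨B2Eq228Conditioning.isProbabilityMeasure_gaussProb hpos.1, hpos.2⟩

/-- The level-0 law `dμ₀ = gaussProb (W_E(C^{(0)})⁻¹)`, `(C^{(0)})⁻¹ = G₁⁻¹`, is a probability measure with positive mass
(given, in addition, the positivity of `⟨·,·⟩_E` itself). [cite: Balaban1982Higgs1, (3.33) p.617] -/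
theorem law₀_isProbabilityMeasure (h : T.Consistent) (E1 : (T.step 1).ScalarProducts WE (W 1) (W (1 + 1)))
    (posE : ∀ u : ι → ℝ, u ≠ 0 → 0 < u ⬝ᵥ (WE *ᵥ u))
    (symW1 : ∀ u v : T.κ 1 → ℝ, u ⬝ᵥ (W 1 *ᵥ v) = v ⬝ᵥ (W 1 *ᵥ u))
    (symH : ∀ φ ψ : ι → ℝ, φ ⬝ᵥ (WE *ᵥ (T.H *ᵥ ψ)) = ψ ⬝ᵥ (WE *ᵥ (T.H *ᵥ φ))) :
    IsProbabilityMeasure (B2Eq228Conditioning.gaussProb (ginvW T WE))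
      ∧ 0 < B13GaugeDevices.gaussNorm (ginvW T WE) := by
  have hpos := gaussNorm_ginv_pos (T.step 1) E1 posE symW1 symH (h.G_arg 1 le_rfl)
  exact ⟨B2Eq228Conditioning.isProbabilityMeasure_gaussProb hpos.1, hpos.2⟩

/-- **The p. 617 sentence in probabilistic form, with the non-degeneracy DISCHARGED**: as `rtIter_eq_mean`, the masses
being positive by `law_isProbabilityMeasure`/`law₀_isProbabilityMeasure`; the only hypothesis beyond those of
`B1Eq333FluctuationIntegrals.rtIter_eq` is the positivity of the scalar product `⟨·,·⟩_E` of the initial lattice.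
[cite: Balaban1982Higgs1, (3.33) p.617] -/
theorem rtIter_eq_mean' (h : T.Consistent) (E : ∀ j, 1 ≤ j → (T.step j).ScalarProducts WE (W j) (W (j + 1)))
    (posE : ∀ u : ι → ℝ, u ≠ 0 → 0 < u ⬝ᵥ (WE *ᵥ u))
    (symE : ∀ φ ψ : ι → ℝ, φ ⬝ᵥ (WE *ᵥ ψ) = ψ ⬝ᵥ (WE *ᵥ φ))
    (symW : ∀ j, 1 ≤ j → ∀ u v : T.κ j → ℝ, u ⬝ᵥ (W j *ᵥ v) = v ⬝ᵥ (W j *ᵥ u))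
    (symH : ∀ φ ψ : ι → ℝ, φ ⬝ᵥ (WE *ᵥ (T.H *ᵥ ψ)) = ψ ⬝ᵥ (WE *ᵥ (T.H *ᵥ φ)))
    (F : (ι → ℝ) → ℝ) (n : ℕ) (B : T.κ (n + 1) → ℝ) :
    rtIter T WE W c F n B
      = (∏ j ∈ Finset.range (n + 1), c j)
        * (Real.exp (-(1 / 2 * (B ⬝ᵥ (W (n + 1) *ᵥ ((T.step (n + 1)).Δk *ᵥ B)))))
          * ((B13GaugeDevices.gaussNorm (ginvW T WE)
              * ∏ j ∈ Finset.Icc 1 n, B13GaugeDevices.gaussNorm (cinvW T W j))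
            * fluctMean T W (fun v => ∫ A' : ι → ℝ, F (A' + v)
                ∂(B2Eq228Conditioning.gaussProb (ginvW T WE))) n (bg T (n + 1) B))) :=
  rtIter_eq_mean c h E symE symW symH F n
    (law₀_isProbabilityMeasure h (E 1 le_rfl) posE (symW 1 le_rfl) symH).2.ne'
    (fun j hj _ => (law_isProbabilityMeasure h E symE symW symH j hj).2.ne') B

end Laws

end Literature.MathematicalPhysics.QuantumFieldTheory.Balaban1983to89.B1Eq335FluctuationMeasure
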